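import Summits.CriticalPhenomena.PercolationContinuityZ3.Theorems.Transplant.FKConnectivityAllQDegThree
import Summits.CriticalPhenomena.PercolationContinuityZ3.Theorems.Transplant.FKConnectivityAllQK4
import Mathlib.GroupTheory.Perm.Cycle.Basic
import HarnessLib

/-!
# Connectivity correlation inequalities for `φ_{w,q}`, every `q > 0` — WHEELS, file 1 (tools): wheels presented by a hub and a
# rim cycle, the fan inside a 2-tree, the base wheel `W₃ = K₄`, splicing out a rim vertex

Support file (`--supports stmt-CriticalPhenomena-4575`), FK sub-lane `prim-bschramm-fk-1` (gen 7) of the post-continuity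
programme; builds on p205010 (kernel theorem, internal audit signed; external expert review pending).  Two definitions
(`wheelEdges`, `fanTree`), no named facts, no sorries; standard axioms.

A wheel is presented by its hub `h` and a cyclic permutation `σ` of the rim (`σ.IsCycle`, `σ h = h`):
`wheelEdges h σ = {s(h, v), s(v, σ v) : σ v ≠ v}`.  This file supplies the combinatorics used by the induction of file 2
(`…Wheels`): (i) every rim vertex other than `x` is `σ^j x`, `1 ≤ j ≤ n − 1` (`n` = number of rim vertices), and these are
distinct; (ii) the FAN at `x` — the pairs of the wheel avoiding `x` plus the spokes to the two rim neighbours of `x` — lies in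
the 2-tree `fanTree h σ x (n − 2)` grown from the pair `h σx` by the apices `σ²x, …, σ^{n−1}x` (`isTwoTree_fanTree`,
`fan_subset_fanTree`); (iii) with three rim vertices the wheel lies in the `K₄` on `h, x, σx, σ⁻¹x`, hence is edge-negatively
associated for `0 < q ≤ 1` (`edgeNegCorrSupp_wheel_three`, from fk-1 g5's `edgeNegCorr_supp_K4`); (iv) SPLICING: the pairs avoiding
`x`, the chord `σ⁻¹x σx` and the spokes `h σ^{±1}x` lie in the wheel with rim `swap x (σ x) * σ` (`wheel_splice_subset`).
[cite: Wagner2006, Ex. 5.1, §5.3] [cite: Grimmett2006, §3.9 eq. (3.94) (p. 63)]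
-/

noncomputable section

namespace Summit.CriticalPhenomena.PercolationContinuityZ3.Theorems

namespace FK

open MeasureTheory Set Literature.Probability.LatticeModels Literature.Probability.Percolation
open scoped Classical

variable {V : Type*} [Fintype V]

/-! ### Wheels presented by a hub and a rim cycle -/

/-- **The edge set of the wheel with hub `h` and rim cycle `σ`**: the spokes `s(h, v)` and the rim pairs `s(v, σ v)` over the
vertices `v` moved by `σ`. [cite: Wagner2006, §5.3] -/
def wheelEdges (h : V) (σ : Equiv.Perm V) : Set (Sym2 V) :=
  {e | ∃ v : V, σ v ≠ v ∧ (e = s(h, v) ∨ e = s(v, σ v))}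

omit [Fintype V] in
/-- Spokes belong to the wheel. [folklore] -/
theorem spoke_mem_wheelEdges (h : V) (σ : Equiv.Perm V) {v : V} (hv : σ v ≠ v) : s(h, v) ∈ wheelEdges h σ :=
  ⟨v, hv, Or.inl rfl⟩

omit [Fintype V] in
/-- Rim pairs belong to the wheel. [folklore] -/
theorem rim_mem_wheelEdges (h : V) (σ : Equiv.Perm V) {v : V} (hv : σ v ≠ v) : s(v, σ v) ∈ wheelEdges h σ :=
  ⟨v, hv, Or.inr rfl⟩

omit [Fintype V] in
/-- The pairs of a wheel at a rim vertex `x` are `x σx`, `x σ⁻¹x` and the spoke `x h`. [folklore] -/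
theorem eq_of_mem_wheelEdges_of_mem {h : V} {σ : Equiv.Perm V} (hh : σ h = h) {x : V} (hx : σ x ≠ x) {e : Sym2 V}
    (he : e ∈ wheelEdges h σ) (hxe : x ∈ e) : e = s(x, σ x) ∨ e = s(x, σ.symm x) ∨ e = s(x, h) := by
  obtain ⟨v, hv, rfl | rfl⟩ := he
  · rw [Sym2.mem_iff] at hxe
    rcases hxe with rfl | rfl
    · exact absurd hh hx
    · exact Or.inr (Or.inr (Sym2.eq_swap))
  · rw [Sym2.mem_iff] at hxe
    rcases hxe with rfl | rfl
    · exact Or.inl rfl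
    · refine Or.inr (Or.inl ?_)
      rw [Equiv.symm_apply_apply, Sym2.eq_swap]

/-! ### Powers of the rim cycle -/

/-- For a cycle `σ` with `n` moved points, every moved point other than `x` is `σ^j x` for some `1 ≤ j ≤ n − 1`. [folklore] -/
theorem exists_pow_eq_of_isCycle {σ : Equiv.Perm V} (hσ : σ.IsCycle) {n : ℕ} (hn : σ.support.card = n) {x v : V}
    (hx : σ x ≠ x) (hv : σ v ≠ v) (hvx : v ≠ x) : ∃ j : ℕ, 1 ≤ j ∧ j ≤ n - 1 ∧ (σ ^ j) x = v := by
  obtain ⟨i, hi⟩ := hσ.exists_pow_eq hx hv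
  have hord : orderOf σ = n := by rw [hσ.orderOf, hn]
  have hnpos : 0 < n := by rw [← hord]; exact orderOf_pos σ
  refine ⟨i % n, ?_, ?_, ?_⟩
  · rcases Nat.eq_zero_or_pos (i % n) with h0 | h0
    · exfalso
      apply hvx
      rw [← hi, ← pow_mod_orderOf, hord, h0, pow_zero, Equiv.Perm.coe_one, id]
    · exact h0
  · have := Nat.mod_lt i hnpos
    omega
  · rw [← hord, pow_mod_orderOf, hi]

/-- For a cycle `σ` with `n` moved points, `σ^n x = x`. [folklore] -/
theorem pow_card_support_apply {σ : Equiv.Perm V} (hσ : σ.IsCycle) {n : ℕ} (hn : σ.support.card = n) (x : V) :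
    (σ ^ n) x = x := by
  have hord : orderOf σ = n := by rw [hσ.orderOf, hn]
  rw [← hord, pow_orderOf_eq_one, Equiv.Perm.coe_one, id]

/-- For a cycle `σ` with `n` moved points and `x` moved, the points `σ^i x`, `σ^j x` with `i, j < n` coincide only if
`i = j`. [folklore] -/
theorem pow_apply_injOn {σ : Equiv.Perm V} (hσ : σ.IsCycle) {n : ℕ} (hn : σ.support.card = n) {x : V} (hx : σ x ≠ x)
    {i j : ℕ} (hi : i < n) (hj : j < n) (hij : (σ ^ i) x = (σ ^ j) x) : i = j := by
  have hc : σ.IsCycleOn (σ.support : Set V) := by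
    have h1 := Equiv.Perm.isCycleOn_support_cycleOf σ x
    rwa [hσ.cycleOf_eq hx] at h1
  have hxs : x ∈ σ.support := Equiv.Perm.mem_support.2 hx
  have key := (hc.pow_apply_eq_pow_apply hxs).1 hij
  rw [hn] at key
  exact Nat.ModEq.eq_of_lt_of_lt key hi hj

/-- `σ⁻¹ x = σ^(n-1) x` for a cycle with `n ≥ 1` moved points. [folklore] -/
theorem symm_apply_eq_pow {σ : Equiv.Perm V} (hσ : σ.IsCycle) {n : ℕ} (hn : σ.support.card = n) (h1 : 1 ≤ n) (x : V) :
    σ.symm x = (σ ^ (n - 1)) x := by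
  apply σ.injective
  rw [Equiv.apply_symm_apply, ← Equiv.Perm.mul_apply, ← pow_succ', Nat.sub_add_cancel h1]
  exact (pow_card_support_apply hσ hn x).symm

/-! ### The fan is a partial 2-tree -/

/-- The growing 2-trees inside the fan at `x`: `fanTree h σ x k` has the spokes `h σ^j x` (`1 ≤ j ≤ k + 1`) and the rim pairs
`σ^{j+1} x σ^j x` (`1 ≤ j ≤ k`). [folklore] -/
def fanTree (h : V) (σ : Equiv.Perm V) (x : V) : ℕ → Set (Sym2 V)
  | 0 => {s(h, σ x)}
  | k + 1 => fanTree h σ x k ∪ {s(h, (σ ^ (k + 2)) x), s((σ ^ (k + 2)) x, (σ ^ (k + 1)) x)}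

omit [Fintype V] in
/-- The fan trees grow. [folklore] -/
theorem fanTree_mono (h : V) (σ : Equiv.Perm V) (x : V) {j k : ℕ} (hjk : j ≤ k) : fanTree h σ x j ⊆ fanTree h σ x k := by
  induction hjk with
  | refl => exact le_rfl
  | step _ ih => exact ih.trans Set.subset_union_left

omit [Fintype V] in
/-- The spoke `h σ^{k+1} x` lies in `fanTree k`. [folklore] -/
theorem spoke_mem_fanTree (h : V) (σ : Equiv.Perm V) (x : V) (k : ℕ) : s(h, (σ ^ (k + 1)) x) ∈ fanTree h σ x k := by
  cases k with
  | zero => simp [fanTree]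
  | succ k => exact Or.inr (Or.inl rfl)

omit [Fintype V] in
/-- The rim pair `σ^{k+2} x σ^{k+1} x` lies in `fanTree (k+1)`. [folklore] -/
theorem rim_mem_fanTree (h : V) (σ : Equiv.Perm V) (x : V) (k : ℕ) :
    s((σ ^ (k + 2)) x, (σ ^ (k + 1)) x) ∈ fanTree h σ x (k + 1) :=
  Or.inr (Or.inr rfl)

omit [Fintype V] in
/-- Vertices covered by `fanTree k`: the hub and `σ^j x`, `1 ≤ j ≤ k + 1`. [folklore] -/
theorem mem_of_mem_fanTree {h : V} {σ : Equiv.Perm V} {x : V} {k : ℕ} {e : Sym2 V} (he : e ∈ fanTree h σ x k) {v : V}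
    (hv : v ∈ e) : v = h ∨ ∃ j : ℕ, 1 ≤ j ∧ j ≤ k + 1 ∧ v = (σ ^ j) x := by
  induction k with
  | zero =>
    simp only [fanTree, Set.mem_singleton_iff] at he
    subst he
    rw [Sym2.mem_iff] at hv
    rcases hv with rfl | rfl
    · exact Or.inl rfl
    · exact Or.inr ⟨1, le_rfl, by omega, by rw [pow_one]⟩
  | succ k ih =>
    rcases he with he | he | he
    · rcases ih he with h1 | ⟨j, hj1, hj2, hj3⟩
      · exact Or.inl h1
      · exact Or.inr ⟨j, hj1, by omega, hj3⟩
    · rw [he, Sym2.mem_iff] at hv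
      rcases hv with rfl | rfl
      · exact Or.inl rfl
      · exact Or.inr ⟨k + 2, by omega, le_rfl, rfl⟩
    · rw [Set.mem_singleton_iff] at he
      rw [he, Sym2.mem_iff] at hv
      rcases hv with rfl | rfl
      · exact Or.inr ⟨k + 2, by omega, le_rfl, rfl⟩
      · exact Or.inr ⟨k + 1, by omega, by omega, rfl⟩

/-- **The fan trees are 2-trees** (while `k + 2 ≤ n`, so that the apices `σ^j x`, `1 ≤ j ≤ k + 1 < n`, are distinct and off the
hub). [cite: Wagner2006, §5.3] -/
theorem isTwoTree_fanTree {h : V} {σ : Equiv.Perm V} (hσ : σ.IsCycle) (hh : σ h = h) {n : ℕ} (hn : σ.support.card = n)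
    {x : V} (hx : σ x ≠ x) : ∀ k : ℕ, k + 2 ≤ n → IsTwoTree (fanTree h σ x k) := by
  intro k
  induction k with
  | zero =>
    intro _
    refine IsTwoTree.pair ?_
    intro hc
    apply hx
    have : σ (σ x) = σ x := by rw [← hc, hh]
    exact σ.injective this
  | succ k ih =>
    intro hk
    have hT := ih (by omega)
    refine IsTwoTree.cons hT (spoke_mem_fanTree h σ x k) ?_
    intro e he hmem
    rcases mem_of_mem_fanTree he hmem with h1 | ⟨j, hj1, hj2, hj3⟩
    · -- σ^{k+2} x is moved, the hub is not
      have hmoved : σ ((σ ^ (k + 2)) x) ≠ (σ ^ (k + 2)) x :=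
        Equiv.Perm.mem_support.1 (Equiv.Perm.pow_apply_mem_support.2 (Equiv.Perm.mem_support.2 hx))
      exact hmoved (by rw [h1, hh])
    · have := pow_apply_injOn hσ hn hx (i := k + 2) (j := j) (by omega) (by omega) hj3
      omega

/-- **The fan at `x` lies in a 2-tree**: every pair of the wheel avoiding the rim vertex `x`, together with the spokes to the two
rim neighbours of `x`, lies in `fanTree (n − 2)`. [cite: Wagner2006, §5.3] -/
theorem fan_subset_fanTree {h : V} {σ : Equiv.Perm V} (hσ : σ.IsCycle) {n : ℕ} (hn : σ.support.card = n)
    (h3 : 3 ≤ n) {x : V} (hx : σ x ≠ x) :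
    {e ∈ wheelEdges h σ | x ∉ e} ∪ {s(h, σ.symm x), s(h, σ x)} ⊆ fanTree h σ x (n - 2) := by
  intro e he
  rcases he with ⟨⟨v, hv, rfl | rfl⟩, hxe⟩ | he | he
  · -- a spoke `h v` with `v ≠ x`
    have hvx : v ≠ x := fun hc => hxe (hc ▸ Sym2.mem_mk_right h v)
    obtain ⟨j, hj1, hj2, rfl⟩ := exists_pow_eq_of_isCycle hσ hn hx hv hvx
    obtain ⟨i, rfl⟩ : ∃ i, j = i + 1 := ⟨j - 1, by omega⟩
    exact fanTree_mono h σ x (by omega) (spoke_mem_fanTree h σ x i)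
  · -- a rim pair `v σv` avoiding `x`
    have hvx : v ≠ x := fun hc => hxe (hc ▸ Sym2.mem_mk_left v (σ v))
    have hsvx : σ v ≠ x := fun hc => hxe (hc ▸ Sym2.mem_mk_right v (σ v))
    obtain ⟨j, hj1, hj2, rfl⟩ := exists_pow_eq_of_isCycle hσ hn hx hv hvx
    have hjn : j + 1 ≠ n := by
      intro hc
      apply hsvx
      rw [← Equiv.Perm.mul_apply, ← pow_succ', hc]
      exact pow_card_support_apply hσ hn x
    obtain ⟨i, rfl⟩ : ∃ i, j = i + 1 := ⟨j - 1, by omega⟩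
    have hmem := rim_mem_fanTree h σ x i
    rw [← Equiv.Perm.mul_apply, ← pow_succ', Sym2.eq_swap]
    exact fanTree_mono h σ x (by omega) hmem
  · -- the spoke to `σ⁻¹ x = σ^{n-1} x`
    rw [he, symm_apply_eq_pow hσ hn (by omega)]
    obtain ⟨i, hi⟩ : ∃ i, n - 1 = i + 1 := ⟨n - 2, by omega⟩
    rw [hi]
    exact fanTree_mono h σ x (by omega) (spoke_mem_fanTree h σ x i)
  · -- the spoke to `σ x`
    rw [Set.mem_singleton_iff] at he
    rw [he]
    have := spoke_mem_fanTree h σ x 0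
    rw [zero_add, pow_one] at this
    exact fanTree_mono h σ x (by omega) this


/-! ### Distinctness facts on a rim with at least three vertices -/

/-- On a rim with at least three vertices, `σ (σ x) ≠ x`. [folklore] -/
theorem apply_apply_ne_of_three_le {σ : Equiv.Perm V} (hσ : σ.IsCycle) {n : ℕ} (hn : σ.support.card = n) (h3 : 3 ≤ n)
    {x : V} (hx : σ x ≠ x) : σ (σ x) ≠ x := by
  intro hc
  have h2 : (σ ^ 2) x = (σ ^ 0) x := by rw [pow_zero, pow_two, Equiv.Perm.mul_apply, hc, Equiv.Perm.coe_one, id]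
  have := pow_apply_injOn hσ hn hx (i := 2) (j := 0) (by omega) (by omega) h2
  omega

/-- On a rim with at least three vertices, the two rim neighbours of `x` differ: `σ⁻¹ x ≠ σ x`. [folklore] -/
theorem symm_apply_ne_apply {σ : Equiv.Perm V} (hσ : σ.IsCycle) {n : ℕ} (hn : σ.support.card = n) (h3 : 3 ≤ n)
    {x : V} (hx : σ x ≠ x) : σ.symm x ≠ σ x := by
  intro hc
  apply apply_apply_ne_of_three_le hσ hn h3 hx
  rw [← hc, Equiv.apply_symm_apply]

omit [Fintype V] in
/-- A point fixed by `σ` differs from every moved point. [folklore] -/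
theorem ne_of_apply_eq_of_apply_ne {σ : Equiv.Perm V} {h v : V} (hh : σ h = h) (hv : σ v ≠ v) : v ≠ h :=
  fun hc => hv (by rw [hc, hh])

omit [Fintype V] in
/-- `σ⁻¹ x` is moved when `x` is. [folklore] -/
theorem symm_apply_ne {σ : Equiv.Perm V} {x : V} (hx : σ x ≠ x) : σ (σ.symm x) ≠ σ.symm x := by
  rw [Equiv.apply_symm_apply]
  intro hc
  apply hx
  conv_lhs => rw [hc]
  rw [Equiv.apply_symm_apply]

omit [Fintype V] in
/-- `σ x` is moved when `x` is. [folklore] -/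
theorem apply_ne {σ : Equiv.Perm V} {x : V} (hx : σ x ≠ x) : σ (σ x) ≠ σ x :=
  fun hc => hx (σ.injective hc)

/-! ### The base wheel `W₃ = K₄` -/

/-- With exactly three rim vertices, the wheel is (inside) the `K₄` on `h, x, σ x, σ⁻¹ x`. [folklore] -/
theorem wheelEdges_subset_K4 {h : V} {σ : Equiv.Perm V} (hσ : σ.IsCycle) (hn : σ.support.card = 3) {x : V} (hx : σ x ≠ x) :
    wheelEdges h σ ⊆ {s(h, x), s(h, σ x), s(h, σ.symm x), s(x, σ x), s(x, σ.symm x), s(σ x, σ.symm x)} := by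
  have hsq : (σ ^ 2) x = σ.symm x := by rw [symm_apply_eq_pow hσ hn (by omega)]
  have hcube : σ (σ.symm x) = x := Equiv.apply_symm_apply σ x
  rintro e ⟨v, hv, rfl | rfl⟩
  · -- spokes
    by_cases hvx : v = x
    · subst hvx; simp
    · obtain ⟨j, hj1, hj2, rfl⟩ := exists_pow_eq_of_isCycle hσ hn hx hv hvx
      interval_cases j
      · simp
      · rw [hsq]; simp
  · -- rim pairs
    by_cases hvx : v = x
    · subst hvx; simp
    · obtain ⟨j, hj1, hj2, rfl⟩ := exists_pow_eq_of_isCycle hσ hn hx hv hvx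
      interval_cases j
      · have : σ ((σ ^ 1) x) = σ.symm x := by rw [← hsq, pow_one, pow_two, Equiv.Perm.mul_apply]
        rw [this, pow_one]; simp
      · rw [hsq, hcube, Sym2.eq_swap]; simp

/-- **All pairs of `W₃ = K₄` are negatively correlated** (`0 < q ≤ 1`; fk-1 g5's kernel certificate of Sokal's computation).
[cite: Wagner2006, Ex. 5.1] -/
theorem edgeNegCorrSupp_wheel_three {q : ℝ} (hq0 : 0 < q) (hq1 : q ≤ 1) {h : V} {σ : Equiv.Perm V} (hσ : σ.IsCycle)
    (hh : σ h = h) (hn : σ.support.card = 3) {x : V} (hx : σ x ≠ x) : EdgeNegCorrSupp (wheelEdges h σ) q := by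
  have hxh : x ≠ h := ne_of_apply_eq_of_apply_ne hh hx
  have hbh : σ x ≠ h := ne_of_apply_eq_of_apply_ne hh (apply_ne hx)
  have hah : σ.symm x ≠ h := ne_of_apply_eq_of_apply_ne hh (symm_apply_ne hx)
  have hab : σ.symm x ≠ σ x := symm_apply_ne_apply hσ hn le_rfl hx
  have hax : σ.symm x ≠ x := by
    intro hc; apply hx; conv_lhs => rw [← hc]; rw [Equiv.apply_symm_apply]
  exact EdgeNegCorrSupp.mono (wheelEdges_subset_K4 hσ hn hx)
    (edgeNegCorr_supp_K4 hq0 hq1 hxh.symm hbh.symm hah.symm (Ne.symm hx) hax.symm hab.symm)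

/-! ### Splicing out a rim vertex -/

omit [Fintype V] in
/-- **Splicing.**  With `σ' = swap x (σ x) * σ` (the rim vertex `x` spliced out of the cycle): every pair of the wheel avoiding
`x`, the chord `σ⁻¹x σx` and the spokes `h σ⁻¹x`, `h σx` all belong to the wheel with rim `σ'`. [folklore] -/
theorem wheel_splice_subset (h : V) {σ : Equiv.Perm V} {x : V} (hx : σ x ≠ x) (hffx : σ (σ x) ≠ x) :
    {e ∈ wheelEdges h σ | x ∉ e} ∪ {s(σ.symm x, σ x), s(σ x, σ.symm x), s(σ.symm x, h), s(σ x, h)} ⊆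
      wheelEdges h (Equiv.swap x (σ x) * σ) := by
  set σ' : Equiv.Perm V := Equiv.swap x (σ x) * σ with hσ'
  have ha' : σ' (σ.symm x) = σ x := by
    rw [hσ', Equiv.Perm.mul_apply, Equiv.apply_symm_apply, Equiv.swap_apply_left]
  have hab : σ.symm x ≠ σ x := by
    intro hc; apply hffx; rw [← hc, Equiv.apply_symm_apply]
  have hma : σ' (σ.symm x) ≠ σ.symm x := by rw [ha']; exact hab.symm
  have hb' : σ' (σ x) = σ (σ x) := by
    rw [hσ', Equiv.Perm.mul_apply, Equiv.swap_apply_of_ne_of_ne hffx (apply_ne hx)]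
  have hmb : σ' (σ x) ≠ σ x := by rw [hb']; exact apply_ne hx
  have hgen : ∀ v, v ≠ x → σ v ≠ x → σ' v = σ v := by
    intro v hvx hsvx
    rw [hσ', Equiv.Perm.mul_apply, Equiv.swap_apply_of_ne_of_ne hsvx (fun hc => hvx (σ.injective hc))]
  rintro e (⟨⟨v, hv, rfl | rfl⟩, hxe⟩ | he)
  · -- spoke `h v`, `v ≠ x`
    have hvx : v ≠ x := fun hc => hxe (hc ▸ Sym2.mem_mk_right h v)
    by_cases hsvx : σ v = x
    · have hva : v = σ.symm x := by rw [← hsvx, Equiv.symm_apply_apply]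
      rw [hva]; exact spoke_mem_wheelEdges h σ' hma
    · exact spoke_mem_wheelEdges h σ' (by rw [hgen v hvx hsvx]; exact hv)
  · -- rim pair `v σv` avoiding `x`
    have hvx : v ≠ x := fun hc => hxe (hc ▸ Sym2.mem_mk_left v (σ v))
    have hsvx : σ v ≠ x := fun hc => hxe (hc ▸ Sym2.mem_mk_right v (σ v))
    have h1 := rim_mem_wheelEdges h σ' (v := v) (by rw [hgen v hvx hsvx]; exact hv)
    rwa [hgen v hvx hsvx] at h1
  · rcases he with rfl | rfl | rfl | he
    · have h1 := rim_mem_wheelEdges h σ' hma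
      rwa [ha'] at h1
    · have h1 := rim_mem_wheelEdges h σ' hma
      rwa [ha', Sym2.eq_swap] at h1
    · rw [Sym2.eq_swap]; exact spoke_mem_wheelEdges h σ' hma
    · rw [Set.mem_singleton_iff.1 he, Sym2.eq_swap]; exact spoke_mem_wheelEdges h σ' hmb

end FK

end Summit.CriticalPhenomena.PercolationContinuityZ3.Theorems

end
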